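import Literature.NumberTheory.EllipticCurves.BigRepModuleShapiroInjectiveProofs
import Mathlib.NumberTheory.Padics.RingHoms
import HarnessLib

/-!
# Shapiro's lemma for the co-induced module `M = A ⊗ Λ^*(Ψ⁻¹)`, LOCAL CONDITIONS, cocycle level —
# a 1-cocycle of `bigRep κ ρ` restricted along a compact `ψ : D → G` is a coboundary iff every
# evaluation `d ↦ c(ψ d)(x)`, `x ∈ ℤ_p`, is a coboundary on `D ∩ ker κ` — PROVED

Topic `Literature/NumberTheory/EllipticCurves`. Theorems only: no definition, no named fact, no `sorry`, no
instance, no notation. Cell `bsd-stepL`, seat `bsd-stepL-defn-ty1` (g7): module M3 ("local conditions match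
under `Sh`") of the discharge plan `NOTE-prop323-Shapiro-discharge-plan-imc-p1-g11` (HOME/imc-p1/g11/) for the
named fact `SkinnerUrban2014.prop323_XAc_equiv_XBigDecomp` ([SU14] Prop. 3.2.3), sequel of
`BigRepModuleShapiroInjectiveProofs.lean` (M1). This file is the GROUP-THEORETIC core; the Selmer-level
statement on `Γ_K` (`selmerBigDecomp` vs `AcSelmer.selmerOver`) is the companion `…ShapiroSelmerConditionsProofs.lean`.

## What is proved (generic `G`, `κ : G →ₜ* ℤ_p`, `ρ` on a discrete `p`-primary `A`, `c : G → M` a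
## continuous 1-cocycle of `bigRep κ ρ`)

[SU14] §3.1.2 ((3.1.2.a)–(3.1.2.b), p. 17) compares Shapiro's isomorphism with restriction to a decomposition
group `G_{F,v}`: the local condition at `v` for the induced module is the family of local conditions at all
`w ∣ v`. In the co-induced model over the `ℤ_p`-tower of `κ`, for a COMPACT `D` with `ψ : D →ₜ* G` (`Γ_{K_w} → Γ_K`):
* **`exists_eq_bigRep_sub_comp_iff`** — `c ∘ ψ` is a coboundary (`∃ Φ, c(ψ d) = ψ(d)·Φ − Φ`: `[c]`
  dies in `H¹(D, M)`, the RIGHT-hand local condition) **iff** for every `x ∈ ℤ_p` the evaluation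
  `d ↦ c(ψ d)(x)` is a coboundary of `ρ` on `D ∩ ker κ` (by `rho_apply_conj_zero` these are the
  classes of the `Γ_K`-conjugates of `Sh(c)` on `ker κ ∩ D`: the LEFT-hand conditions at the places
  of `K_∞` above `w`). `⟹` is evaluation; `⟸` (`exists_eq_bigRep_sub_of_forall_apply`) is proved
  on `D` by the dichotomy `forall_kappa_eq_one_or_exists_range_eq` — the compact image `κ(D)` is an
  ideal of the DVR `ℤ_p`, so `0` or `p^m ℤ_p`: if `κ(D) = 0` (split completely) a uniform level of
  `c` on `D` gives smooth primitives `a_{x mod pⁿ}` (`exists_forall_ker_eq_bigRep_sub`); if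
  `κ(D) = p^m ℤ_p` (finitely decomposed) M1's primitive is built on each of the finitely many open
  cosets `r + p^m ℤ_p` (`exists_eq_bigRep_sub_of_range_eq_span_pow`; `m = 0` is M1's theorem).
* **`rho_apply_conj_zero`** — for `κ h = 1`: `ρ(σ)·c(σ⁻¹hσ)(0) = c(h)(κ σ) + (ρ(h)b − b)`, `b = c(σ)(κ σ)`:
  `conj_σ(Sh c)` is evaluation at `x = κ σ` up to a coboundary (M4-core's `conj_apply_zero_eq` is `κ σ = 1`).

HONEST FRAMING: group cohomology of an induced module; nothing about elliptic curves, Selmer groups or BSD;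
the named fact `prop323_…` is NOT discharged by this file.

References: [SkinnerUrban2014] §3.1.1–3.1.2 ((3.1.2.a)–(3.1.2.b), pp. 16–18), Prop. 3.2.3 and its proof (pp. 21–22:
"then follows from the analysis in 3.1.2"); [SerreGaloisCohomology1997] I §2.5 (Shapiro's lemma); tree:
`AnticyclotomicBigGaloisRep.lean` (`BigRepModule`, `bigRep`, `translate`), `BigRepModuleShapiroInjectiveProofs.lean` (M1).
-/

noncomputable section

open Filter Topology Multiplicative
open Literature.NumberTheory.GaloisRepresentations

namespace Literature.NumberTheory.EllipticCurves.BigRepModule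

universe u

variable {𝒪 : Type*} [CommRing 𝒪] {p : ℕ} [Fact p.Prime] {A : Type u} [AddCommGroup A] [Module 𝒪 A]

/-! ## §1 Residues modulo `p^m` and uniform levels -/

section Residues

omit [AddCommGroup A] [Module 𝒪 A] in
/-- `p^m ℤ_p` is open in `ℤ_p` (the closed ball of radius `p^{-m}` in an ultrametric space). [folklore] -/
private theorem isOpen_span_pow (m : ℕ) : IsOpen (Ideal.span {(p : ℤ_[p]) ^ m} : Set ℤ_[p]) := by
  have hball : (Ideal.span {(p : ℤ_[p]) ^ m} : Set ℤ_[p]) =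
      Metric.closedBall (0 : ℤ_[p]) ((p : ℝ) ^ (-(m : ℤ))) := by
    ext x
    rw [SetLike.mem_coe, Metric.mem_closedBall, dist_zero_right,
      PadicInt.norm_le_pow_iff_mem_span_pow]
  rw [hball]
  exact IsUltrametricDist.isOpen_closedBall _
    (zpow_ne_zero _ (Nat.cast_ne_zero.2 (Fact.out : p.Prime).ne_zero))

omit [AddCommGroup A] [Module 𝒪 A] in
/-- **A locally constant system of representatives of `ℤ_p / p^m ℤ_p`**: `rep : ℤ_p → ℤ_p` with
`x ≡ rep x (mod p^m)`, constant on cosets of `p^m ℤ_p`, of finite range (`x ↦ x mod p^m`, Mathlib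
`PadicInt.toZModPow`). [folklore] -/
private theorem exists_residueRep (m : ℕ) : ∃ rep : ℤ_[p] → ℤ_[p],
    (∀ x, x - rep x ∈ Ideal.span {(p : ℤ_[p]) ^ m}) ∧
      (∀ x y, x - y ∈ Ideal.span {(p : ℤ_[p]) ^ m} → rep x = rep y) ∧ (Set.range rep).Finite := by
  haveI : NeZero (p ^ m) := ⟨pow_ne_zero _ (Fact.out : p.Prime).ne_zero⟩
  refine ⟨fun x ↦ ((PadicInt.toZModPow m x).val : ℤ_[p]), fun x ↦ ?_, fun x y hxy ↦ ?_, ?_⟩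
  · rw [← PadicInt.ker_toZModPow, RingHom.mem_ker, map_sub, map_natCast, ZMod.natCast_zmod_val,
      sub_self]
  · have h : PadicInt.toZModPow m x = PadicInt.toZModPow m y := by
      rw [← sub_eq_zero, ← map_sub, ← RingHom.mem_ker, PadicInt.ker_toZModPow]
      exact hxy
    simp only [h]
  · exact (Set.finite_range fun r : ZMod (p ^ m) ↦ ((r.val : ℕ) : ℤ_[p])).subset
      (Set.range_comp_subset_range (PadicInt.toZModPow m) fun r : ZMod (p ^ m) ↦ ((r.val : ℕ) : ℤ_[p]))

omit [AddCommGroup A] [Module 𝒪 A] in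
/-- A function of level `n` has every level `m ≥ n` (`p^m ℤ_p ⊆ p^n ℤ_p`).
[cite: SkinnerUrban2014, §3.1.1 (the transition maps of `lim→ Maps(Γ/Γ^{pⁿ}, ·)`)] -/
theorem isSmoothOfLevel_of_le {n m : ℕ} (hnm : n ≤ m) {Φ : ℤ_[p] → A}
    (hΦ : IsSmoothOfLevel p A n Φ) : IsSmoothOfLevel p A m Φ := fun x y hxy ↦
  hΦ x y (Ideal.span_singleton_le_span_singleton.2 (pow_dvd_pow _ hnm) hxy)

/-- **Uniform level on a compact space**: a continuous map `c : X → M` from a compact space into the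
(discrete) big module takes finitely many values, so all `c(x)` are smooth of one common level `n`.
[cite: SkinnerUrban2014, §3.1.1 and proof of Prop. 3.2.3 (`Λ^* = lim→ Maps(Γ/Γ^{pⁿ}, ·)`)] -/
theorem exists_forall_isSmoothOfLevel {X : Type*} [TopologicalSpace X] [CompactSpace X]
    {c : X → BigRepModule 𝒪 p A} (hc : Continuous c) :
    ∃ n : ℕ, ∀ x, IsSmoothOfLevel p A n (c x) := by
  classical
  have hfin : (Set.range c).Finite := ((IsLocallyConstant.iff_continuous c).2 hc).range_finite
  have hval : ∀ Φ ∈ hfin.toFinset, ∃ n : ℕ, IsSmoothOfLevel p A n Φ := fun Φ _ ↦ Φ.exists_level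
  choose! nv hnv using hval
  refine ⟨hfin.toFinset.sup nv, fun x ↦ ?_⟩
  have hx : c x ∈ hfin.toFinset := hfin.mem_toFinset.2 ⟨x, rfl⟩
  exact isSmoothOfLevel_of_le (Finset.le_sup hx) (hnv _ hx)

end Residues

/-! ## §2 Evaluation of a coboundary; the conjugation identity -/

section Cocycle

variable [TopologicalSpace 𝒪] [TopologicalSpace A] [DiscreteTopology A]
  {G : Type u} [Group G] [TopologicalSpace G] [IsTopologicalGroup G]
  [TopologicalSpace (PowerSeries 𝒪)]
  (κ : G →ₜ* Multiplicative ℤ_[p]) (ρ : ContinuousRep G 𝒪 A)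

/-- **`⟹` (evaluation): a coboundary on `g` with `κ g = 1` evaluates to coboundaries of `ρ`**:
if `c(g) = g·Φ − Φ` and `κ g = 1` then `c(g)(x) = ρ(g)(Φ x) − Φ x` for every `x ∈ ℤ_p` (an element
of `ker κ` does not move the argument). [cite: SkinnerUrban2014, §3.1.2 ((3.1.2.a), p. 17) and Prop. 3.2.3] -/
theorem apply_eq_sub_of_eq_bigRep_sub {c : G → BigRepModule 𝒪 p A} {Φ : BigRepModule 𝒪 p A}
    {g : G} (hg : c g = bigRep κ ρ g Φ - Φ) (hκ : κ g = 1) (x : ℤ_[p]) :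
    c g x = ρ g (Φ x) - Φ x := by
  rw [hg, BigRepModule.sub_apply, bigRep_apply_apply, hκ, toAdd_one, sub_zero]

/-- **The conjugation identity.** For a 1-cocycle `c` of `bigRep κ ρ`, `σ ∈ G` and `h ∈ ker κ`:
`ρ(σ)·c(σ⁻¹ h σ)(0) = c(h)(κ σ) + (ρ(h) b − b)`, `b = c(σ)(κ σ)` — the `σ`-conjugate of
`Sh(c) = (h ↦ c(h)(0))` is, up to a coboundary, the evaluation of `c` at `κ σ ∈ ℤ_p = Γ_K / ker κ`:
Shapiro turns conjugates by `Γ_K` (LEFT) into places of `K_∞` above `v` ((3.1.2.a):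
`φ_w(g) = φ(g g_w)`). (M4-core's `conj_apply_zero_eq` is `κ σ = 1`.) [cite: SkinnerUrban2014, §3.1.2 ((3.1.2.a), p. 17: "`φ ↦ (φ_w)_{w∣v}`, `φ_w(g) := φ(g g_w)`")] -/
theorem rho_apply_conj_zero {c : G → BigRepModule 𝒪 p A}
    (hc : ∀ g h : G, c (g * h) = c g + bigRep κ ρ g (c h)) (σ : G) {h : G} (hh : κ h = 1) :
    ρ σ (c (σ⁻¹ * h * σ) 0) =
      c h (κ σ).toAdd + (ρ h (c σ (κ σ).toAdd) - c σ (κ σ).toAdd) := by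
  have h1 : c 1 = 0 := by
    have := hc 1 1
    rwa [mul_one, map_one, Module.End.one_apply, left_eq_add] at this
  have hσσ : ∀ y : A, ρ σ (ρ σ⁻¹ y) = y := fun y ↦ by
    rw [← Module.End.mul_apply, ← map_mul, mul_inv_cancel, map_one, Module.End.one_apply]
  -- `ρ(σ) c(σ⁻¹)(0) = - c(σ)(κ σ)` from `c(σ σ⁻¹) = c(1) = 0`
  have hinv : ρ σ (c σ⁻¹ 0) = -c σ (κ σ).toAdd := by
    have h0 := congrArg (fun Ψ : BigRepModule 𝒪 p A ↦ Ψ (κ σ).toAdd) (hc σ σ⁻¹)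
    simp only [mul_inv_cancel, h1, BigRepModule.zero_apply, BigRepModule.add_apply,
      bigRep_apply_apply, sub_self] at h0
    rw [eq_neg_iff_add_eq_zero, add_comm]
    exact h0.symm
  -- `c(σ⁻¹ h σ) = c(σ⁻¹) + σ⁻¹·(c(h) + h·c(σ))`, evaluated at `0`
  have hmain := congrArg (fun Ψ : BigRepModule 𝒪 p A ↦ Ψ 0) (hc σ⁻¹ (h * σ))
  rw [hc h σ] at hmain
  simp only [BigRepModule.add_apply, bigRep_apply_apply, map_add, map_inv, toAdd_inv, zero_sub,
    neg_neg, hh, toAdd_one, sub_zero] at hmain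
  rw [← mul_assoc] at hmain
  rw [hmain, map_add (ρ σ), map_add (ρ σ), hinv, hσσ, hσσ]
  abel

/-- **Right `ker κ`-invariance of M1's primitive, parameter `r ∈ ℤ_p`**: if `c(h)(r) = ρ(h)a − a` on
`ker κ`, then `F_r(g) = ρ(g)a − c(g)(κ g + r)` has `F_r(g h) = F_r(g)` for `κ h = 1` (a function of
`r + κ g ∈ ℤ_p`; M1's `shapiroPrimitiveFun_mul_of_ker` is `r = 0`).
[cite: SkinnerUrban2014, Prop. 3.2.3 (proof) with §3.1.2 ((3.1.2.a))] -/
theorem primitiveFun_mul_of_ker {c : G → BigRepModule 𝒪 p A}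
    (hc : ∀ g h : G, c (g * h) = c g + bigRep κ ρ g (c h)) {r : ℤ_[p]} {a : A}
    (hSh : ∀ h : G, κ h = 1 → c h r = ρ h a - a) (g : G) {h : G} (hh : κ h = 1) :
    ρ (g * h) a - c (g * h) ((κ (g * h)).toAdd + r) = ρ g a - c g ((κ g).toAdd + r) := by
  have hκ : (κ (g * h)).toAdd = (κ g).toAdd := by rw [map_mul, hh, mul_one]
  rw [hκ, hc, BigRepModule.add_apply, bigRep_apply_apply, add_sub_cancel_left, hSh h hh, map_mul,
    Module.End.mul_apply, map_sub]
  abel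

/-! ## §3 `⟸`, the split case: `κ(D) = 0` (and the reduction to `c|_{ker κ} = 0`) -/

/-- **Smooth choice of primitives on `ker κ` (compact `G`).** If `c : G → M` is continuous and every
evaluation `h ↦ c(h)(x)` is a coboundary of `ρ` on `ker κ`, then ONE `Φ₀ ∈ M` has `c(h) = h·Φ₀ − Φ₀`
for all `h ∈ ker κ` (`Φ₀(x) := a_{x mod pⁿ}`, `n` a uniform level of `c`). So if `κ(G) = 0` (a place
split completely in `K_∞/K`: `D_v ⊆ ker κ`) `c` is a coboundary. (`c` need not be a cocycle.)
[cite: SkinnerUrban2014, §3.1.2 ((3.1.2.a)–(3.1.2.b), pp. 17–18) and Prop. 3.2.3 (proof)] -/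
theorem exists_forall_ker_eq_bigRep_sub [CompactSpace G] (hA : ∀ a : A, ∃ k : ℕ, p ^ k • a = 0)
    {c : G → BigRepModule 𝒪 p A} (hcont : Continuous c)
    (hSh : ∀ x : ℤ_[p], ∃ a : A, ∀ h : G, κ h = 1 → c h x = ρ h a - a) :
    ∃ Φ : BigRepModule 𝒪 p A, ∀ h : G, κ h = 1 → c h = bigRep κ ρ h Φ - Φ := by
  classical
  obtain ⟨n, hn⟩ := exists_forall_isSmoothOfLevel hcont
  choose a ha using hSh
  obtain ⟨rep, hrep, hrep', hfin⟩ := exists_residueRep (p := p) n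
  have hlev : IsSmoothOfLevel p A n (fun x ↦ a (rep x)) := fun x y hxy ↦ by
    simp only [hrep' x y hxy]
  have htor : ∀ x, ∃ k : ℕ, p ^ k • (fun x ↦ a (rep x)) x = 0 := fun x ↦ hA _
  have hfin' : (Set.range (a ∘ rep)).Finite := by
    rw [Set.range_comp]
    exact hfin.image a
  obtain ⟨k, hk⟩ := exists_uniform_pow_smul_eq_zero hfin' htor
  refine ⟨BigRepModule.mk (fun x ↦ a (rep x)) ⟨⟨n, hlev⟩, ⟨k, hk⟩⟩, fun h hh ↦ ?_⟩
  ext x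
  rw [BigRepModule.sub_apply, bigRep_apply_apply, hh, toAdd_one, sub_zero, BigRepModule.mk_apply,
    hn h x (rep x) (hrep x)]
  exact ha (rep x) h hh

/-! ## §4 The dichotomy for the image `κ(D) ⊆ ℤ_p` -/

omit [TopologicalSpace 𝒪] [TopologicalSpace A] [DiscreteTopology A] [IsTopologicalGroup G]
  [TopologicalSpace (PowerSeries 𝒪)] in
/-- **The image of a compact group in `ℤ_p` is `0` or `p^m ℤ_p`**: `κ(G)` is a compact, hence
closed, subgroup, stable under `ℤ_p`-multiples by density of `ℕ`, i.e. an ideal of the DVR `ℤ_p`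
(Mathlib `PadicInt.ideal_eq_span_pow_p`). For `G = D_v`: `v` splits completely in `K_∞/K`, or is
finitely decomposed. [folklore] -/
private theorem forall_kappa_eq_one_or_exists_range_eq [CompactSpace G] :
    (∀ g : G, κ g = 1) ∨
      ∃ m : ℕ, ∀ y : ℤ_[p], (∃ g : G, (κ g).toAdd = y) ↔ y ∈ Ideal.span {(p : ℤ_[p]) ^ m} := by
  classical
  have hSc : IsClosed (Set.range fun g : G ↦ (κ g).toAdd) :=
    (isCompact_range (continuous_toAdd.comp κ.continuous_toFun)).isClosed
  have hmul : ∀ (b : ℤ_[p]) {y : ℤ_[p]}, y ∈ Set.range (fun g : G ↦ (κ g).toAdd) →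
      b * y ∈ Set.range (fun g : G ↦ (κ g).toAdd) := by
    intro b y hy
    obtain ⟨g, rfl⟩ := hy
    have hcl : IsClosed {b : ℤ_[p] | b * (κ g).toAdd ∈ Set.range fun g : G ↦ (κ g).toAdd} :=
      hSc.preimage (continuous_id.mul continuous_const)
    refine PadicInt.denseRange_natCast.induction_on b hcl fun k ↦ ?_
    exact ⟨g ^ k, by simp only [map_pow, toAdd_pow, nsmul_eq_mul]⟩
  let I : Ideal ℤ_[p] :=
    { carrier := Set.range fun g : G ↦ (κ g).toAdd
      add_mem' := by
        rintro _ _ ⟨g, rfl⟩ ⟨h, rfl⟩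
        exact ⟨g * h, by simp only [map_mul, toAdd_mul]⟩
      zero_mem' := ⟨1, by simp only [map_one, toAdd_one]⟩
      smul_mem' := fun b y hy ↦ hmul b hy }
  by_cases hI : I = ⊥
  · refine Or.inl fun g ↦ ?_
    have hg : (κ g).toAdd ∈ I := ⟨g, rfl⟩
    rw [hI, Ideal.mem_bot] at hg
    apply toAdd.injective
    rw [toAdd_one]
    exact hg
  · obtain ⟨m, hm⟩ := PadicInt.ideal_eq_span_pow_p hI
    refine Or.inr ⟨m, fun y ↦ ?_⟩
    change y ∈ I ↔ _
    rw [hm]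

/-! ## §5 `⟸`, the finitely decomposed case: `κ(D) = p^m ℤ_p` (M1's primitive per coset) -/

/-- **Shapiro injectivity with parameters, `κ(G) = p^m ℤ_p`.** `G` compact, `κ(G)` EXACTLY
`p^m ℤ_p`, `c` a continuous 1-cocycle of `bigRep κ ρ` whose evaluations `h ↦ c(h)(x)` are
coboundaries of some `a_x` on `ker κ`: then `c = ∂Φ` for the `Φ ∈ M` given on the open coset
`r + p^m ℤ_p` (`r` the canonical representative) by `Φ(r + κ g) = ρ(g) a_r − c(g)(κ g + r)` — M1's
primitive (`m = 0`) coset by coset; smooth because on each coset the set where `Φ` avoids a value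
is the continuous image of a compact subset of `G`.
[cite: SkinnerUrban2014, §3.1.2 ((3.1.2.a)–(3.1.2.b), pp. 17–18: Shapiro versus restriction to `G_{F,v}`, product over `w ∣ v`) and Prop. 3.2.3 (proof)]
[cite: SerreGaloisCohomology1997, I §2.5 (Shapiro's lemma)] -/
theorem exists_eq_bigRep_sub_of_range_eq_span_pow [CompactSpace G]
    (hA : ∀ a : A, ∃ k : ℕ, p ^ k • a = 0)
    {c : G → BigRepModule 𝒪 p A} (hcont : Continuous c)
    (hc : ∀ g h : G, c (g * h) = c g + bigRep κ ρ g (c h)) {m : ℕ}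
    (hκ : ∀ y : ℤ_[p], (∃ g : G, (κ g).toAdd = y) ↔ y ∈ Ideal.span {(p : ℤ_[p]) ^ m})
    (hSh : ∀ x : ℤ_[p], ∃ a : A, ∀ h : G, κ h = 1 → c h x = ρ h a - a) :
    ∃ Φ : BigRepModule 𝒪 p A, ∀ g : G, c g = bigRep κ ρ g Φ - Φ := by
  classical
  choose a ha using hSh
  obtain ⟨rep, hrep, hrep', -⟩ := exists_residueRep (p := p) m
  have hκmem : ∀ g : G, (κ g).toAdd ∈ Ideal.span {(p : ℤ_[p]) ^ m} := fun g ↦ (hκ _).1 ⟨g, rfl⟩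
  have hsec : ∀ x : ℤ_[p], ∃ g : G, (κ g).toAdd = x - rep x := fun x ↦ (hκ _).2 (hrep x)
  choose sec hsec using hsec
  have hFc : ∀ (r : ℤ_[p]) (b : A), Continuous fun g : G ↦ ρ g b - c g ((κ g).toAdd + r) := by
    intro r b
    have := continuous_shapiroPrimitiveFun (κ := κ) (ρ := ρ)
      (c := fun g ↦ translate r (c g)) (continuous_of_discreteTopology.comp hcont) b
    simpa only [translate_apply] using this
  obtain ⟨Φf, hΦf⟩ : ∃ Φf : ℤ_[p] → A,
      ∀ x, Φf x = ρ (sec x) (a (rep x)) - c (sec x) ((κ (sec x)).toAdd + rep x) :=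
    ⟨_, fun _ ↦ rfl⟩
  have hkey : ∀ (x : ℤ_[p]) (g : G), (κ g).toAdd = x - rep x →
      Φf x = ρ g (a (rep x)) - c g ((κ g).toAdd + rep x) := by
    intro x g hg
    have h1 : κ (g⁻¹ * sec x) = 1 := by
      apply toAdd.injective
      rw [map_mul, map_inv, toAdd_mul, toAdd_inv, hsec, hg, toAdd_one, neg_add_cancel]
    have h2 := primitiveFun_mul_of_ker κ ρ hc (ha (rep x)) g h1
    rw [mul_inv_cancel_left] at h2
    rw [hΦf, h2]
  have hΦc : Continuous Φf := by
    refine ((IsLocallyConstant.iff_eventually_eq Φf).2 fun x₀ ↦ ?_).continuous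
    have hπ : Continuous fun g : G ↦ (κ g).toAdd + rep x₀ :=
      (continuous_toAdd.comp κ.continuous_toFun).add continuous_const
    -- the bad set `T` (closed: continuous image of a compact set) and the open coset of `x₀`
    obtain ⟨T, hT⟩ : ∃ T : Set ℤ_[p], T = (fun g : G ↦ (κ g).toAdd + rep x₀) ''
        ((fun g : G ↦ ρ g (a (rep x₀)) - c g ((κ g).toAdd + rep x₀)) ⁻¹' {Φf x₀}ᶜ) := ⟨_, rfl⟩
    have hbad : IsClosed T := hT ▸ ((((isClosed_discrete ({Φf x₀}ᶜ : Set A)).preimage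
      (hFc (rep x₀) (a (rep x₀)))).isCompact).image hπ).isClosed
    have hopen : IsOpen ({x : ℤ_[p] | x - x₀ ∈ Ideal.span {(p : ℤ_[p]) ^ m}} ∩ Tᶜ) :=
      ((isOpen_span_pow (p := p) m).preimage (continuous_id.sub continuous_const)).inter
        hbad.isOpen_compl
    have hmem : x₀ ∈ {x : ℤ_[p] | x - x₀ ∈ Ideal.span {(p : ℤ_[p]) ^ m}} ∩ Tᶜ := by
      refine ⟨?_, ?_⟩
      · show x₀ - x₀ ∈ Ideal.span {(p : ℤ_[p]) ^ m}
        rw [sub_self]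
        exact Ideal.zero_mem _
      · rw [hT]
        rintro ⟨g, hg, hgx⟩
        exact hg (hkey x₀ g (eq_sub_of_add_eq hgx)).symm
    filter_upwards [hopen.mem_nhds hmem] with x hx
    obtain ⟨hxC, hxT⟩ := hx
    rw [hT] at hxT
    have hrx : rep x = rep x₀ := hrep' x x₀ hxC
    by_contra hne
    refine hxT ⟨sec x, ?_, show (κ (sec x)).toAdd + rep x₀ = x by rw [hsec, hrx, sub_add_cancel]⟩
    show ρ (sec x) (a (rep x₀)) - c (sec x) ((κ (sec x)).toAdd + rep x₀) ∈ ({Φf x₀} : Set A)ᶜ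
    rw [Set.mem_compl_iff, Set.mem_singleton_iff, ← hrx, ← hΦf]
    exact hne
  obtain ⟨n, hn⟩ := exists_isSmoothOfLevel_of_continuous hΦc
  have htor : ∀ x : ℤ_[p], ∃ k : ℕ, p ^ k • Φf x = 0 := by
    intro x
    obtain ⟨k₁, hk₁⟩ := hA (a (rep x))
    obtain ⟨k₂, hk₂⟩ := (c (sec x)).exists_torsion
    refine ⟨k₁ + k₂, ?_⟩
    have h₁ : p ^ (k₁ + k₂) • ρ (sec x) (a (rep x)) = 0 := by
      rw [pow_add, mul_comm, mul_smul, ← map_nsmul, hk₁, map_zero, smul_zero]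
    have h₂ : p ^ (k₁ + k₂) • c (sec x) ((κ (sec x)).toAdd + rep x) = 0 := by
      rw [pow_add, mul_smul, hk₂, smul_zero]
    rw [hΦf, smul_sub, h₁, h₂, sub_zero]
  obtain ⟨k, hk⟩ := exists_uniform_pow_smul_eq_zero
    (((IsLocallyConstant.iff_continuous Φf).2 hΦc).range_finite) htor
  refine ⟨BigRepModule.mk Φf ⟨⟨n, hn⟩, ⟨k, hk⟩⟩, fun g ↦ ?_⟩
  -- `c(g) = g·Φ − Φ`, read at `x`: the cocycle identity `c(g_x) = c(g) + g·c(g⁻¹ g_x)`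
  ext x
  have hx' : rep (x - (κ g).toAdd) = rep x :=
    hrep' _ _ (by rw [sub_sub_cancel_left]; exact neg_mem (hκmem g))
  have hκ' : (κ (g⁻¹ * sec x)).toAdd = (x - (κ g).toAdd) - rep (x - (κ g).toAdd) := by
    rw [hx', map_mul, map_inv, toAdd_mul, toAdd_inv, hsec]
    abel
  have h2 := hkey (x - (κ g).toAdd) (g⁻¹ * sec x) hκ'
  rw [hx'] at h2
  rw [BigRepModule.sub_apply, bigRep_apply_apply, BigRepModule.mk_apply, BigRepModule.mk_apply, h2,
    hΦf x]
  have hcoc : c (sec x) = c g + bigRep κ ρ g (c (g⁻¹ * sec x)) := by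
    rw [← hc, mul_inv_cancel_left]
  have hval := congrArg (fun Ψ : BigRepModule 𝒪 p A ↦ Ψ x) hcoc
  simp only [BigRepModule.add_apply, bigRep_apply_apply] at hval
  have e1 : (κ (g⁻¹ * sec x)).toAdd + rep x = x - (κ g).toAdd := by
    rw [map_mul, map_inv, toAdd_mul, toAdd_inv, hsec]
    abel
  have e2 : (κ (sec x)).toAdd + rep x = x := by rw [hsec, sub_add_cancel]
  rw [e1, e2, map_sub (ρ g), ← Module.End.mul_apply, ← map_mul, mul_inv_cancel_left, hval]
  abel

/-! ## §6 `⟸` assembled, and the equivalence along `ψ : D → G` -/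

/-- **Local Shapiro injectivity with parameters (compact `G`, any image)**: a continuous 1-cocycle
`c` of `bigRep κ ρ` all of whose evaluations `h ↦ c(h)(x)` are coboundaries of `ρ` on `ker κ` is a
coboundary — dichotomy `κ(G) = 0` (`exists_forall_ker_eq_bigRep_sub`) or `= p^m ℤ_p`
(`exists_eq_bigRep_sub_of_range_eq_span_pow`).
[cite: SkinnerUrban2014, §3.1.2 ((3.1.2.a)–(3.1.2.b), pp. 17–18) and Prop. 3.2.3 (proof)]
[cite: SerreGaloisCohomology1997, I §2.5 (Shapiro's lemma)] -/
theorem exists_eq_bigRep_sub_of_forall_apply [CompactSpace G]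
    (hA : ∀ a : A, ∃ k : ℕ, p ^ k • a = 0)
    {c : G → BigRepModule 𝒪 p A} (hcont : Continuous c)
    (hc : ∀ g h : G, c (g * h) = c g + bigRep κ ρ g (c h))
    (hSh : ∀ x : ℤ_[p], ∃ a : A, ∀ h : G, κ h = 1 → c h x = ρ h a - a) :
    ∃ Φ : BigRepModule 𝒪 p A, ∀ g : G, c g = bigRep κ ρ g Φ - Φ := by
  rcases forall_kappa_eq_one_or_exists_range_eq κ with htriv | ⟨m, hm⟩
  · obtain ⟨Φ, hΦ⟩ := exists_forall_ker_eq_bigRep_sub κ ρ hA hcont hSh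
    exact ⟨Φ, fun g ↦ hΦ g (htriv g)⟩
  · exact exists_eq_bigRep_sub_of_range_eq_span_pow κ ρ hA hcont hc hm hSh

/-- **LOCAL CONDITIONS UNDER SHAPIRO, cocycle level.** For a continuous 1-cocycle `c : G → M` of
`bigRep κ ρ` (`A` discrete `p`-primary) and `ψ : D →ₜ* G` from a COMPACT group (a decomposition
group `Γ_{K_w} → Γ_K`): `c ∘ ψ` is a coboundary — `[c]` dies in `H¹(D, M)`, the local condition of
`Sel(K, T ⊗ Λ^*)` at `w` — IFF every evaluation `d ↦ c(ψ d)(x)`, `x ∈ ℤ_p`, is a coboundary of `ρ`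
on `D ∩ ker κ` — by `rho_apply_conj_zero`, the classes of the `Γ_K`-conjugates of
`Sh(c) = (h ↦ c(h)(0))` die on `ker κ ∩ ψ(D)`: the local conditions of `Sel(K_∞, A)` at the places of
`K_∞` above `w`. This is [SU14] (3.1.2.a)–(3.1.2.b) ("the bottom isomorphism of (3.1.2.b) identifies
`H¹(k_v, Ind M)` with `∏_{w∣v} H¹(E_w, M)`") in the limit over the `ℤ_p`-tower, both decomposition
types at once. [cite: SkinnerUrban2014, §3.1.2 ((3.1.2.a)–(3.1.2.b), pp. 17–18) and Prop. 3.2.3 ("then follows from the analysis in 3.1.2", p. 22)]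
[cite: SerreGaloisCohomology1997, I §2.5 (Shapiro's lemma)] -/
theorem exists_eq_bigRep_sub_comp_iff {D : Type u} [Group D] [TopologicalSpace D]
    [IsTopologicalGroup D] [CompactSpace D] (ψ : D →ₜ* G)
    (hA : ∀ a : A, ∃ k : ℕ, p ^ k • a = 0)
    {c : G → BigRepModule 𝒪 p A} (hcont : Continuous c)
    (hc : ∀ g h : G, c (g * h) = c g + bigRep κ ρ g (c h)) :
    (∃ Φ : BigRepModule 𝒪 p A, ∀ d : D, c (ψ d) = bigRep κ ρ (ψ d) Φ - Φ) ↔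
      ∀ x : ℤ_[p], ∃ a : A, ∀ d : D, κ (ψ d) = 1 → c (ψ d) x = ρ (ψ d) a - a := by
  constructor
  · rintro ⟨Φ, hΦ⟩ x
    exact ⟨Φ x, fun d hd ↦ apply_eq_sub_of_eq_bigRep_sub κ ρ (hΦ d) hd x⟩
  · intro h
    have hc' : ∀ d e : D,
        c (ψ (d * e)) = c (ψ d) + bigRep (κ.comp ψ) (ρ.restrict ψ) d (c (ψ e)) := by
      intro d e
      have := hc (ψ d) (ψ e)
      rw [← map_mul] at this
      exact this
    obtain ⟨Φ, hΦ⟩ := exists_eq_bigRep_sub_of_forall_apply (κ.comp ψ) (ρ.restrict ψ) hA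
      (c := fun d ↦ c (ψ d)) (hcont.comp ψ.continuous_toFun) hc' h
    exact ⟨Φ, fun d ↦ hΦ d⟩

end Cocycle

end Literature.NumberTheory.EllipticCurves.BigRepModule

end
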